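import Summits.QuantumFields.YangMills.Theorems.SwapVirialDeficitBlowUpGnomonicRotCovariance
import Summits.QuantumFields.YangMills.Theorems.SwapVirialDeficitBlowUpGnomonicApexProjection
import HarnessLib

/-!
# The tip leader letters after the joint rotation: flat base point plus a rotated STIFF displacement

Sub-problem `SwapVirialDeficit`, crux ⟨stmt-QuantumFields-24197⟩ `SwapGluedStiffness`, skeleton ➎, stub `stub_core_tip`, socket (hCore), brick (F2b) of w3 g68's
design (HOME memo `w3-g68-memo-hCore-24197.md` §2(ii)), consumed by w2 g61's ✓`abs_log_det_tip_mod_rot` (the point `ζ` there) and by the K7g group-distance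
version of its translation step.  In joint/relative letters the tip leader point over the base `p = (x₀,y₀)` is
`η = ((x₀·(1,τ) − (0, y₀ρ)), (y₀·(1,τ) + (0, x₀ρ)), z, F)`; with the unit quaternion `u = u_τ` of ✓`exists_gnoRot_gnoBase_eq_jointTilt`
(`rot3 u e₀ = (1,τ)/λ`, `λ = √(1+|τ|²)`):
* `gnoRot_add` — `gnoRot u (η + η') = gnoRot u η + gnoRot u η'`;
* ★ `tipRot_letters` — `gnoRot ū η = gnoBase (λx₀) (λy₀) + gnoRot ū stiff`, `stiff = ((0,−y₀ρ), (0, x₀ρ), z, F)`;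
* ★ `tipRot_letters_compressed` — for `ζ = gnoRot ū η`: `|ζ.x⊥|² ≤ y₀²|ρ|²`, `|ζ.y⊥|² ≤ x₀²|ρ|²`, `|ζ.x|² = |x|²`, `|ζ.y|² = |y|²`, `|ζ.z|² = |z|²`
  (the transverse sizes entering ✓`leaderGroupDist_le` / K7g are the RELATIVE tilt only — the joint tilt has been rotated away — and the compressions are unchanged).

HONEST LABEL: letter bookkeeping only; (hCore), `stub_core_tip`, ⟨24197⟩, ⟨24194⟩ remain OPEN; nothing here proves the Yang–Mills mass gap.
-/

noncomputable section

open Quaternion Set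
open scoped Quaternion
open Literature.MathematicalPhysics.QuantumLattice
open Literature.MathematicalPhysics.QuantumFieldTheory hiding SU2

namespace Summit.QuantumFields.YangMills.Theorems.SwapVirialDeficit.BlowUpRing

open Summit.QuantumFields.YangMills.Theorems.FemtoTransferGap
open Summit.QuantumFields.YangMills.Theorems.FemtoTransferGap.TT
open Summit.QuantumFields.YangMills.Theorems.SwapVirialDeficit.Gnomonic (normSq3)

variable {L : ℕ} [NeZero L]

omit [NeZero L] in
/-- `gnoRot u` is additive. [folklore] -/
theorem gnoRot_add (u : ℍ) (η η' : GnoCoord L) : gnoRot u (η + η') = gnoRot u η + gnoRot u η' := by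
  refine Prod.ext (Prod.ext ?_ ?_) (Prod.ext ?_ (funext fun f => ?_))
  · exact rot3_add u η.1.1 η'.1.1
  · exact rot3_add u η.1.2 η'.1.2
  · exact rot3_add u η.2.1 η'.2.1
  · exact rot3_add u (η.2.2 f) (η'.2.2 f)

omit [NeZero L] in
/-- The transverse part of a vector is at most its length: `v₁² + v₂² ≤ |v|²`. [folklore] -/
theorem transverse_sq_le_normSq3 (v : Fin 3 → ℝ) : (v 1) ^ 2 + (v 2) ^ 2 ≤ normSq3 v := by
  rw [normSq3_eq_three']; nlinarith [sq_nonneg (v 0)]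

omit [NeZero L] in
/-- ★ **THE TIP LETTERS AFTER THE JOINT ROTATION**: with `u = u_τ` (`rot3 u e₀ = (1,τ)/λ`),
`gnoRot ū ((x₀(1,τ) − (0,y₀ρ)), (y₀(1,τ) + (0,x₀ρ)), z, F) = gnoBase (λx₀) (λy₀) + gnoRot ū ((0,−y₀ρ), (0,x₀ρ), z, F)`. [folklore] -/
theorem tipRot_letters (p : ℝ × ℝ) (τ ρ : Fin 2 → ℝ) (z : Fin 3 → ℝ) (F : Fol L → Fin 3 → ℝ) :
    ∃ u : ℍ, ‖u‖ = 1 ∧ rot3 u ![1, 0, 0] = (Real.sqrt (1 + (τ 0 ^ 2 + τ 1 ^ 2)))⁻¹ • (![1, τ 0, τ 1] : Fin 3 → ℝ) ∧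
      gnoRot (star u) ((((![p.1, p.1 * τ 0 - p.2 * ρ 0, p.1 * τ 1 - p.2 * ρ 1] : Fin 3 → ℝ),
          (![p.2, p.2 * τ 0 + p.1 * ρ 0, p.2 * τ 1 + p.1 * ρ 1] : Fin 3 → ℝ)), (z, F)) : GnoCoord L) =
        gnoBase (Real.sqrt (1 + (τ 0 ^ 2 + τ 1 ^ 2)) * p.1) (Real.sqrt (1 + (τ 0 ^ 2 + τ 1 ^ 2)) * p.2) +
          gnoRot (star u) ((((![0, -(p.2 * ρ 0), -(p.2 * ρ 1)] : Fin 3 → ℝ), (![0, p.1 * ρ 0, p.1 * ρ 1] : Fin 3 → ℝ)), (z, F)) : GnoCoord L) := by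
  obtain ⟨u, hu, hrot, hbase⟩ := exists_gnoRot_gnoBase_eq_jointTilt (L := L) p τ
  refine ⟨u, hu, hrot, ?_⟩
  have hsplit : ((((![p.1, p.1 * τ 0 - p.2 * ρ 0, p.1 * τ 1 - p.2 * ρ 1] : Fin 3 → ℝ),
          (![p.2, p.2 * τ 0 + p.1 * ρ 0, p.2 * τ 1 + p.1 * ρ 1] : Fin 3 → ℝ)), (z, F)) : GnoCoord L) =
      ((((![p.1, p.1 * τ 0, p.1 * τ 1] : Fin 3 → ℝ), (![p.2, p.2 * τ 0, p.2 * τ 1] : Fin 3 → ℝ)), ((0 : Fin 3 → ℝ), (0 : Fol L → Fin 3 → ℝ))) : GnoCoord L) +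
        ((((![0, -(p.2 * ρ 0), -(p.2 * ρ 1)] : Fin 3 → ℝ), (![0, p.1 * ρ 0, p.1 * ρ 1] : Fin 3 → ℝ)), (z, F)) : GnoCoord L) := by
    refine Prod.ext (Prod.ext (funext fun i => ?_) (funext fun i => ?_)) (Prod.ext ?_ ?_)
    · fin_cases i <;> simp <;> ring
    · fin_cases i <;> simp
    · simp
    · simp
  rw [hsplit, gnoRot_add, ← hbase, gnoRot_star_gnoRot hu]

omit [NeZero L] in
/-- ★ **THE COMPRESSED SIZES AFTER THE ROTATION**: for `ζ = gnoBase (λx₀) (λy₀) + gnoRot ū stiff` as in `tipRot_letters` (any unit `u`):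
the transverse parts are `≤ y₀²|ρ|²`, `≤ x₀²|ρ|²`, and `|ζ.z|² = |z|²`. [folklore] -/
theorem tipRot_letters_compressed {u : ℍ} (hu : ‖u‖ = 1) (p : ℝ × ℝ) (lam : ℝ) (ρ : Fin 2 → ℝ) (z : Fin 3 → ℝ) (F : Fol L → Fin 3 → ℝ) :
    ((gnoBase (lam * p.1) (lam * p.2) +
          gnoRot (star u) ((((![0, -(p.2 * ρ 0), -(p.2 * ρ 1)] : Fin 3 → ℝ), (![0, p.1 * ρ 0, p.1 * ρ 1] : Fin 3 → ℝ)), (z, F)) : GnoCoord L)).1.1 1) ^ 2 +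
        ((gnoBase (lam * p.1) (lam * p.2) +
          gnoRot (star u) ((((![0, -(p.2 * ρ 0), -(p.2 * ρ 1)] : Fin 3 → ℝ), (![0, p.1 * ρ 0, p.1 * ρ 1] : Fin 3 → ℝ)), (z, F)) : GnoCoord L)).1.1 2) ^ 2 ≤
        p.2 ^ 2 * (ρ 0 ^ 2 + ρ 1 ^ 2) ∧
      ((gnoBase (lam * p.1) (lam * p.2) +
          gnoRot (star u) ((((![0, -(p.2 * ρ 0), -(p.2 * ρ 1)] : Fin 3 → ℝ), (![0, p.1 * ρ 0, p.1 * ρ 1] : Fin 3 → ℝ)), (z, F)) : GnoCoord L)).1.2 1) ^ 2 +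
        ((gnoBase (lam * p.1) (lam * p.2) +
          gnoRot (star u) ((((![0, -(p.2 * ρ 0), -(p.2 * ρ 1)] : Fin 3 → ℝ), (![0, p.1 * ρ 0, p.1 * ρ 1] : Fin 3 → ℝ)), (z, F)) : GnoCoord L)).1.2 2) ^ 2 ≤
        p.1 ^ 2 * (ρ 0 ^ 2 + ρ 1 ^ 2) ∧
      normSq3 ((gnoBase (lam * p.1) (lam * p.2) +
          gnoRot (star u) ((((![0, -(p.2 * ρ 0), -(p.2 * ρ 1)] : Fin 3 → ℝ), (![0, p.1 * ρ 0, p.1 * ρ 1] : Fin 3 → ℝ)), (z, F)) : GnoCoord L)).2.1) = normSq3 z := by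
  have hsu : ‖star u‖ = 1 := by rw [Quaternion.norm_star]; exact hu
  set sx : Fin 3 → ℝ := ![0, -(p.2 * ρ 0), -(p.2 * ρ 1)] with hsx
  set sy : Fin 3 → ℝ := ![0, p.1 * ρ 0, p.1 * ρ 1] with hsy
  have ex1 : (gnoBase (lam * p.1) (lam * p.2) + gnoRot (star u) (((sx, sy), (z, F)) : GnoCoord L)).1.1 1 = rot3 (star u) sx 1 := by
    show (![lam * p.1, 0, 0] : Fin 3 → ℝ) 1 + rot3 (star u) sx 1 = _; simp
  have ex2 : (gnoBase (lam * p.1) (lam * p.2) + gnoRot (star u) (((sx, sy), (z, F)) : GnoCoord L)).1.1 2 = rot3 (star u) sx 2 := by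
    show (![lam * p.1, 0, 0] : Fin 3 → ℝ) 2 + rot3 (star u) sx 2 = _; simp
  have ey1 : (gnoBase (lam * p.1) (lam * p.2) + gnoRot (star u) (((sx, sy), (z, F)) : GnoCoord L)).1.2 1 = rot3 (star u) sy 1 := by
    show (![lam * p.2, 0, 0] : Fin 3 → ℝ) 1 + rot3 (star u) sy 1 = _; simp
  have ey2 : (gnoBase (lam * p.1) (lam * p.2) + gnoRot (star u) (((sx, sy), (z, F)) : GnoCoord L)).1.2 2 = rot3 (star u) sy 2 := by
    show (![lam * p.2, 0, 0] : Fin 3 → ℝ) 2 + rot3 (star u) sy 2 = _; simp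
  have ez : (gnoBase (lam * p.1) (lam * p.2) + gnoRot (star u) (((sx, sy), (z, F)) : GnoCoord L)).2.1 = rot3 (star u) z := by
    show (0 : Fin 3 → ℝ) + rot3 (star u) z = _; simp
  have nsx : normSq3 sx = p.2 ^ 2 * (ρ 0 ^ 2 + ρ 1 ^ 2) := by rw [hsx, normSq3_eq_three']; simp; ring
  have nsy : normSq3 sy = p.1 ^ 2 * (ρ 0 ^ 2 + ρ 1 ^ 2) := by rw [hsy, normSq3_eq_three']; simp; ring
  refine ⟨?_, ?_, ?_⟩
  · rw [ex1, ex2, ← nsx, ← normSq3_rot3 hsu sx]; exact transverse_sq_le_normSq3 _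
  · rw [ey1, ey2, ← nsy, ← normSq3_rot3 hsu sy]; exact transverse_sq_le_normSq3 _
  · rw [ez, normSq3_rot3 hsu]

end Summit.QuantumFields.YangMills.Theorems.SwapVirialDeficit.BlowUpRing

end
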